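import Literature.NumberTheory.EllipticCurves.ModularCurveEtaQuotientsProofs
import HarnessLib

/-!
# `η`-quotients of odd weight with character `χ₋₄`: the weight-one forms
# `η(2τ)¹⁰/(η(τ)η(4τ))⁴` and `η(4τ)¹⁰/(η(2τ)η(8τ))⁴` on `Γ₁(8)`

`ModularCurveEtaQuotientsProofs` proves Newman's criterion for `η`-quotients
`f = ∏_{δ ∣ N} η(δτ)^{r_δ}` in EVEN weight with trivial character.  Here we treat the complementary
"theta-type" case needed for weight one: exponent vectors with

  `Σ r_δ = 2k`, `Σ δ r_δ = 0`, `Σ (N/δ) r_δ = 0`, all `r_δ` even     (`ThetaTypeCond N r k`),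

for which we PROVE the transformation law on all of `Γ₀(N)` (`4 ∣ N`)

  `f(γτ) = χ₋₄(d)^k (cτ + d)^k f(τ)`,  `γ = (a b; c d) ∈ Γ₀(N)`,  `χ₋₄(d) = (-1)^{(d-1)/2}`

(`etaQuotient_smul_of_thetaType`; from the transformation law of `η`, `eta_SL2_smul` of
`ModularCurveEtaMultiplierProofs`, in Petersson–Knopp's second form: the Jacobi symbols
`(c_δ/|d|)^{r_δ}` are `(±1)^{even} = 1` and the exponents add up to
`((a-2d)c' - bdc'²N) Σ(N/δ)r_δ + bd Σδr_δ + (3d-3) Σr_δ = 6k(d-1)`, whence the multiplier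
`e^{πik(d-1)/2} = χ₋₄(d)^k`), hence `f ∣[k] γ = f` for `γ ∈ Γ₁(N)`; together with the size of
`f ∣[k] γ` at `i∞` for EVERY `γ ∈ SL₂(ℤ)` (`exists_norm_sq_etaQuotient_slash`:
`‖(f|γ)(τ)‖² = C e^{-π·ord·Im τ/(6N)} (1 + o(1))`, `C > 0`, `ord = cuspOrder24 N r c` Ligozat's
order) this makes `f` a **modular form of weight `k` on `Γ₁(N)`** whenever all orders are `≥ 0`
(`etaQuotientFormOfThetaType`), non-vanishing on `ℍ`, and with `|f ∣[k] γ| → √C > 0` at every cusp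
of order `0` (`tendsto_norm_etaQuotient_slash_of_cuspOrder24_eq_zero`).

The two instances used for Deligne–Serre's weight-one theorem
(`DeligneSerreProp27WeightOneDescentProofs`):

* `thetaSqExp`, `thetaSqTwoExp`: the exponent vectors of `η(2τ)¹⁰ η(τ)⁻⁴ η(4τ)⁻⁴` (classically
  `= θ(τ)²`, `θ = Σ q^{n²}` — an identity we neither prove nor use) and of
  `η(4τ)¹⁰ η(2τ)⁻⁴ η(8τ)⁻⁴` (the same at `2τ`), both of theta type in weight `1` at level `8`
  (`thetaTypeCond_thetaSqExp`, `thetaTypeCond_thetaSqTwoExp`, by `decide`);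
* their orders at the cusps of level `8`: `cuspOrder24 8 thetaSqExp c = 0, 96, 0, 0` and
  `cuspOrder24 8 thetaSqTwoExp c = 0, 0, 192, 0` for `gcd(c, 8) = 1, 2, 4, 8` — non-negative, and
  **at every cusp at least one of the two is `0`** (`cuspOrder24_thetaSq_eq_zero_or`): the two
  forms have no common zero on `ℍ ∪ {cusps}` (`thetaSqForm_ne_zero`,
  `exists_eventually_le_norm_thetaSqForm_slash`);
* the modular forms `thetaSqForm8`, `thetaSqTwoForm8 ∈ M₁(Γ₁(8))` and, for `8 ∣ N`,
  `thetaSqForm N`, `thetaSqTwoForm N ∈ M₁(Γ₁(N))` (`ofLevelLe`, `Gamma1_le_Gamma1_of_dvd`; the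
  `Γ₀` analogue `gamma0_le_gamma0_of_dvd` is in `ModularCurveGenusTwoProofs`), with
  `g ∣[1] γ = χ₋₄(d) • g` for `γ ∈ Γ₀(N)` (`thetaSqForm_slash_of_mem_Gamma0`).

## References

* H. Petersson / M. I. Knopp, *Modular functions in analytic number theory* (1970), Ch. 4, Thm. 2
  (the multiplier system of `η`). [Knopp1970]
* G. Köhler, *Eta products and theta series identities*, Springer 2011, Cor. 2.3 and §1.2 (odd
  weight `η`-quotients, character `(−4/d)`; `θ = η(2τ)⁵/(η(τ)²η(4τ)²)`).
* G. Ligozat, *Courbes modulaires de genre 1*, Mém. SMF 43 (1975) (orders at the cusps).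
-/

noncomputable section

open UpperHalfPlane hiding I
open ModularForm Complex Matrix.SpecialLinearGroup Filter Asymptotics CongruenceSubgroup Topology
open scoped MatrixGroups Real ModularForm NumberTheorySymbols

namespace Literature.NumberTheory.EllipticCurves.ModularForms

/-! ### The sign `χ₋₄(d)` -/

/-- `χ₋₄(d)` for odd `d`: `-1` if `d ≡ 3 (mod 4)`, else `1` (the value at even `d` is junk).
[folklore] -/
def chi4 (d : ℤ) : ℂ := if d % 4 = 3 then -1 else 1

/-- `χ₋₄(2e + 1) = (-1)^e`. [folklore] -/
theorem chi4_eq_neg_one_zpow {d e : ℤ} (h : d = 2 * e + 1) : chi4 d = (-1 : ℂ) ^ e := by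
  unfold chi4
  rcases Int.even_or_odd e with he | ho
  · rw [if_neg (by obtain ⟨m, rfl⟩ := he; omega), he.neg_one_zpow]
  · rw [if_pos (by obtain ⟨m, rfl⟩ := ho; omega), ho.neg_one_zpow]

/-- `χ₋₄(-d) = -χ₋₄(d)` for odd `d`. [folklore] -/
theorem chi4_neg {d : ℤ} (hd : Odd d) : chi4 (-d) = -chi4 d := by
  obtain ⟨e, rfl⟩ := hd
  unfold chi4
  rcases Int.emod_two_eq_zero_or_one e with he | he
  · rw [if_pos (by omega), if_neg (by omega)]
  · rw [if_neg (by omega), if_pos (by omega), neg_neg]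

/-- `χ₋₄(d) = 1` if `d ≡ 1 (mod 4)`. [folklore] -/
theorem chi4_of_emod_four_eq_one {d : ℤ} (h : d % 4 = 1) : chi4 d = 1 := by
  unfold chi4
  rw [if_neg (by omega)]

/-- `χ₋₄(d) ∈ {±1}`, so `χ₋₄(d)² = 1`. [folklore] -/
theorem chi4_mul_self (d : ℤ) : chi4 d * chi4 d = 1 := by
  unfold chi4
  split_ifs <;> norm_num

/-- `‖χ₋₄(d)‖ = 1`. [folklore] -/
theorem norm_chi4 (d : ℤ) : ‖chi4 d‖ = 1 := by
  unfold chi4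
  split_ifs <;> simp

/-! ### Theta-type exponent vectors -/

/-- **Theta-type conditions** on an exponent vector `r` at level `N` in weight `k`:
`Σ r_δ = 2k`, `Σ δ r_δ = 0`, `Σ (N/δ) r_δ = 0` and all `r_δ` even — the hypotheses under which
`∏ η(δτ)^{r_δ}` transforms under `Γ₀(N)` with the character `χ₋₄^k` (Köhler 2011, Cor. 2.3 with
`24 ∣ Σδr_δ`, `24 ∣ Σ(N/δ)r_δ` sharpened to `= 0`, and `∏ δ^{r_δ}` a square). [folklore] -/
structure ThetaTypeCond (N : ℕ) (r : ℕ → ℤ) (k : ℤ) : Prop where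
  /-- the weight condition `Σ r_δ = 2k` -/
  sum_eq : ∑ δ ∈ N.divisors, r δ = 2 * k
  /-- `Σ δ r_δ = 0` (order `0` at `∞`, integral `q`-expansion) -/
  sum_mul_eq : ∑ δ ∈ N.divisors, (δ : ℤ) * r δ = 0
  /-- `Σ (N/δ) r_δ = 0` (order `0` at the cusp `0`) -/
  sum_div_eq : ∑ δ ∈ N.divisors, ((N / δ : ℕ) : ℤ) * r δ = 0
  /-- all exponents are even (so that the Jacobi symbols drop out) -/
  even : ∀ δ ∈ N.divisors, Even (r δ)

/-- **The exponent sum** for a theta-type vector: with `c = c' N`,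
`Σ_δ r_δ P₂(a, bδ, c'(N/δ), d) = 6k(d - 1)`, where `P₂` is the second Petersson–Knopp exponent;
indeed the sum is `((a - 2d)c' - bdc'²N) Σ(N/δ)r_δ + bd Σδr_δ + (3d - 3) Σr_δ`. [folklore] -/
theorem thetaType_exponent_sum {N : ℕ} {r : ℕ → ℤ} {k : ℤ} (hc : ThetaTypeCond N r k)
    (a b c' d : ℤ) :
    ∑ δ ∈ N.divisors, r δ * etaP₂ a (b * δ) (c' * (N / δ : ℕ)) d = 6 * k * (d - 1) := by
  have hpt : ∀ δ ∈ N.divisors, r δ * etaP₂ a (b * δ) (c' * (N / δ : ℕ)) d =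
      ((a - 2 * d) * c' - b * d * c' ^ 2 * N) * (((N / δ : ℕ) : ℤ) * r δ) + b * d * ((δ : ℤ) * r δ)
        + (3 * d - 3) * r δ := fun δ hδ ↦ by
    have hNδ : (δ : ℤ) * ((N / δ : ℕ) : ℤ) = N := by
      exact_mod_cast Nat.mul_div_cancel' (Nat.dvd_of_mem_divisors hδ)
    unfold etaP₂
    linear_combination (-(b * d * c' ^ 2 * ((N / δ : ℕ) : ℤ) * r δ)) * hNδ
  rw [Finset.sum_congr rfl hpt, Finset.sum_add_distrib, Finset.sum_add_distrib, ← Finset.mul_sum,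
    ← Finset.mul_sum, ← Finset.mul_sum, hc.sum_eq, hc.sum_mul_eq, hc.sum_div_eq]
  ring

/-- **The Jacobi part is trivial**: for `gcd(c, d) = 1`, `N ∣ c = δ c_δ` and all `r_δ` even,
`∏_δ (c_δ/|d|)^{r_δ} = 1` (each symbol is `±1`, as `gcd(c_δ, d) = 1`). [folklore] -/
theorem thetaType_jacobi_prod_eq_one (N : ℕ) (r : ℕ → ℤ) (heven : ∀ δ ∈ N.divisors, Even (r δ))
    (c d : ℤ) (hcop : IsCoprime c d) (cδ : ℕ → ℤ) (hcδ : ∀ δ ∈ N.divisors, c = δ * cδ δ) :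
    ∏ δ ∈ N.divisors, ((J(cδ δ | d.natAbs) : ℤ) : ℂ) ^ (r δ) = 1 := by
  refine Finset.prod_eq_one fun δ hδ ↦ ?_
  have hdvd : cδ δ ∣ c := ⟨δ, by rw [hcδ δ hδ, mul_comm]⟩
  have hcop' : IsCoprime (cδ δ) d := hcop.of_isCoprime_of_dvd_left hdvd
  have hg : (cδ δ).gcd d.natAbs = 1 := by
    have : Int.gcd (cδ δ) d = 1 := Int.isCoprime_iff_gcd_eq_one.mp hcop'
    simpa [Int.gcd, Int.natAbs_abs] using this
  obtain ⟨m, hm⟩ := heven δ hδ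
  rw [hm, ← two_mul, zpow_mul, show (2 : ℤ) = ((2 : ℕ) : ℤ) from rfl, zpow_natCast, sq]
  rcases jacobiSym.eq_one_or_neg_one hg with h | h <;> rw [h] <;> norm_num

/-- **The multiplier**: `e^{πi · 6k(d-1)/12} = χ₋₄(d)^k` for odd `d`. [folklore] -/
theorem cexp_thetaType_multiplier (k : ℤ) {d : ℤ} (hd : Odd d) :
    cexp (π * I / 12 * ((6 * k * (d - 1) : ℤ) : ℂ)) = chi4 d ^ k := by
  obtain ⟨e, rfl⟩ := hd
  rw [chi4_eq_neg_one_zpow (e := e) rfl, ← zpow_mul, mul_comm e k,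
    show π * I / 12 * ((6 * k * (2 * e + 1 - 1) : ℤ) : ℂ) = ((k * e : ℤ) : ℂ) * (π * I) by
      push_cast; ring, Complex.exp_int_mul, Complex.exp_pi_mul_I]

/-! ### The transformation law under `Γ₀(N)` -/

/-- **Theta-type `η`-quotients, core case** `c > 0`, `d` odd, `N ∣ c`:
`f(γτ) = χ₋₄(d)^k (cτ + d)^k f(τ)`.  Proof: by the transformation law of `η` (`eta_SL2_smul`)
applied to the conjugates `γ_δ = (a, bδ; c/δ, d)`, `f(γτ) = [∏_δ v_η(γ_δ)^{r_δ}] (cτ + d)^k f(τ)`,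
and the bracket is `χ₋₄(d)^k` by `thetaType_jacobi_prod_eq_one`, `thetaType_exponent_sum` and
`cexp_thetaType_multiplier` (cf. `etaQuotient_SL2_smul_of_odd`, the even-weight case). [folklore] -/
theorem etaQuotient_SL2_smul_of_thetaType (N : ℕ) (hN : 0 < N) (r : ℕ → ℤ) (k : ℤ)
    (hc : ThetaTypeCond N r k) (γ : SL(2, ℤ)) (hγN : (N : ℤ) ∣ γ 1 0) (hcpos : 0 < γ 1 0)
    (hd : Odd (γ 1 1)) (τ : ℍ) :
    etaQuotient N r (γ • τ) =
      chi4 (γ 1 1) ^ k * ((γ 1 0 : ℂ) * τ + γ 1 1) ^ k * etaQuotient N r τ := by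
  obtain ⟨cN, hcN⟩ := hγN
  have hcNpos : 0 < cN := by
    rcases lt_trichotomy cN 0 with h | h | h
    · nlinarith [hcN]
    · rw [h, mul_zero] at hcN; omega
    · exact h
  -- the conjugates `γ_δ`, `c/δ = cN (N/δ)`
  have hcδ : ∀ δ ∈ N.divisors, γ 1 0 = δ * (cN * (N / δ : ℕ)) := fun δ hδ ↦ by
    have hNδ : ((δ : ℕ) : ℤ) * ((N / δ : ℕ) : ℤ) = N := by
      exact_mod_cast Nat.mul_div_cancel' (Nat.dvd_of_mem_divisors hδ)
    rw [hcN, ← hNδ]; ring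
  have hcδpos : ∀ δ ∈ N.divisors, 0 < cN * (N / δ : ℕ) := fun δ hδ ↦
    mul_pos hcNpos (by exact_mod_cast Nat.div_pos (Nat.divisor_le hδ) (Nat.pos_of_mem_divisors hδ))
  set j : ℂ := (γ 1 0 : ℂ) * τ + γ 1 1 with hj
  have hjne : j ≠ 0 := SL2_denom_ne_zero γ τ
  -- each factor
  have hfactor : ∀ δ ∈ N.divisors, η (δ * ((γ • τ : ℍ) : ℂ)) =
      etaMultiplier (γ 0 0) (γ 0 1 * δ) (cN * (N / δ : ℕ)) (γ 1 1) * Complex.sqrt j *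
        η (δ * (τ : ℂ)) := fun δ hδ ↦ by
    have hδ0 := Nat.pos_of_mem_divisors hδ
    obtain ⟨h00, h01, h10, h11⟩ := conjDelta_apply γ δ _ (hcδ δ hδ)
    have := eta_SL2_smul (conjDelta γ δ _ (hcδ δ hδ)) (Or.inl (by rw [h10]; exact hcδpos δ hδ))
      (natMulPt δ hδ0 τ)
    rw [natMul_coe_SL2_smul γ δ hδ0 _ (hcδ δ hδ), this, etaMultiplierSL, h00, h01, h10, h11,
      coe_natMulPt]
    congr 2
    rw [hj]
    have : ((γ 1 0 : ℤ) : ℂ) = δ * (cN * (N / δ : ℕ) : ℤ) := by exact_mod_cast hcδ δ hδ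
    rw [this]; push_cast; ring
  rw [etaQuotient_apply, etaQuotient_apply, Finset.prod_congr rfl fun δ hδ ↦ by rw [hfactor δ hδ]]
  simp_rw [mul_zpow, Finset.prod_mul_distrib]
  -- the automorphy factors: `∏ (√j)^{r_δ} = (√j)^{2k} = j^k`
  have hsqrt : ∏ δ ∈ N.divisors, Complex.sqrt j ^ (r δ) = j ^ k := by
    have hsne : Complex.sqrt j ≠ 0 := fun h ↦ hjne (by rw [← csqrt_sq j, h]; simp)
    rw [show (∏ δ ∈ N.divisors, Complex.sqrt j ^ (r δ)) =
        Complex.sqrt j ^ (∑ δ ∈ N.divisors, r δ) by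
      induction N.divisors using Finset.induction_on with
      | empty => simp
      | insert a s ha ih => rw [Finset.prod_insert ha, Finset.sum_insert ha, ih, zpow_add₀ hsne],
      hc.sum_eq, zpow_mul, show Complex.sqrt j ^ (2 : ℤ) = j by
        rw [show (2 : ℤ) = ((2 : ℕ) : ℤ) from rfl, zpow_natCast, csqrt_sq]]
  -- the multipliers: Jacobi part and exponential part
  have hmult : ∏ δ ∈ N.divisors,
      etaMultiplier (γ 0 0) (γ 0 1 * δ) (cN * (N / δ : ℕ)) (γ 1 1) ^ (r δ) = chi4 (γ 1 1) ^ k := by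
    rw [Finset.prod_congr rfl fun δ hδ ↦ by
      rw [etaMultiplier_of_odd_d (hcδpos δ hδ) hd, mul_zpow, ← Complex.exp_int_mul]]
    rw [Finset.prod_mul_distrib, ← Complex.exp_sum]
    have hcop : IsCoprime (γ 1 0) (γ 1 1) := by
      refine ⟨γ 1 1 * 0 + -γ 0 1, γ 0 0, ?_⟩
      linear_combination det_entries γ
    rw [thetaType_jacobi_prod_eq_one N r hc.even (γ 1 0) (γ 1 1) hcop
      (fun δ ↦ cN * (N / δ : ℕ)) hcδ, one_mul]
    have hsum := thetaType_exponent_sum hc (γ 0 0) (γ 0 1) cN (γ 1 1)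
    rw [show (∑ δ ∈ N.divisors, (r δ : ℂ) * (π * I / 12 *
        (etaP₂ (γ 0 0) (γ 0 1 * δ) (cN * (N / δ : ℕ)) (γ 1 1) : ℤ))) =
        π * I / 12 * ((6 * k * (γ 1 1 - 1) : ℤ) : ℂ) by
      rw [← hsum, Int.cast_sum, Finset.mul_sum]
      exact Finset.sum_congr rfl fun δ _ ↦ by push_cast; ring]
    exact cexp_thetaType_multiplier k hd
  rw [hmult, hsqrt]

/-- In `SL₂(ℤ)`, if `c` is even then `d` is odd. [folklore] -/
theorem odd_d_of_even_c' (γ : SL(2, ℤ)) (hc : Even (γ 1 0)) : Odd (γ 1 1) := by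
  by_contra h
  rw [Int.not_odd_iff_even] at h
  have : Even (γ 0 0 * γ 1 1 - γ 0 1 * γ 1 0) := (h.mul_left _).sub (hc.mul_left _)
  rw [det_entries] at this
  exact Int.not_even_one this

/-- **Theta-type `η`-quotients on all of `Γ₀(N)`** (`4 ∣ N`):
`f(γτ) = χ₋₄(d)^k (cτ + d)^k f(τ)` for every `γ = (a b; c d) ∈ Γ₀(N)`.  Here `d` is odd since
`c` is even; the case `c < 0` follows from `c > 0` applied to `-γ` (`χ₋₄(-d) = -χ₋₄(d)` absorbs the
sign `(-1)^k`), and `c = 0` means `γ = ±Tⁿ` (periodicity, `24 ∣ Σδr_δ = 0`). [folklore] -/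
theorem etaQuotient_smul_of_thetaType (N : ℕ) (hN : 0 < N) (h4 : 4 ∣ N) (r : ℕ → ℤ) (k : ℤ)
    (hc : ThetaTypeCond N r k) {γ : SL(2, ℤ)} (hγ : γ ∈ Gamma0 N) (τ : ℍ) :
    etaQuotient N r (γ • τ) =
      chi4 (γ 1 1) ^ k * ((γ 1 0 : ℂ) * τ + γ 1 1) ^ k * etaQuotient N r τ := by
  have h1 : (24 : ℤ) ∣ ∑ δ ∈ N.divisors, (δ : ℤ) * r δ := by rw [hc.sum_mul_eq]; exact dvd_zero _
  have hdvd_of_mem : ∀ {γ : SL(2, ℤ)}, γ ∈ Gamma0 N → (N : ℤ) ∣ γ 1 0 := fun hγ ↦ by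
    rw [Gamma0_mem] at hγ
    exact (ZMod.intCast_zmod_eq_zero_iff_dvd _ N).mp hγ
  have hodd_of_dvd : ∀ {γ : SL(2, ℤ)}, (N : ℤ) ∣ γ 1 0 → Odd (γ 1 1) := fun {γ} hNc ↦
    odd_d_of_even_c' γ (by
      obtain ⟨m, hm⟩ := ((show (4 : ℤ) ∣ (N : ℤ) by exact_mod_cast h4).trans hNc)
      exact ⟨2 * m, by rw [hm]; ring⟩)
  rcases lt_trichotomy (γ 1 0) 0 with hneg | hzero | hpos
  · -- `c < 0`: use `-γ`
    have hNc' : (N : ℤ) ∣ (-γ) 1 0 := by rw [SL_neg_apply]; exact (hdvd_of_mem hγ).neg_right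
    have h := etaQuotient_SL2_smul_of_thetaType N hN r k hc (-γ) hNc'
      (by rw [SL_neg_apply]; linarith) (hodd_of_dvd hNc') τ
    rw [SL_neg_apply, SL_neg_apply, show (-γ) • τ = γ • τ by simp,
      chi4_neg (hodd_of_dvd (hdvd_of_mem hγ))] at h
    rw [h]
    set jj : ℂ := (γ 1 0 : ℂ) * τ + γ 1 1 with hjj
    have e1 : (((-γ 1 0 : ℤ) : ℂ) * τ + ((-γ 1 1 : ℤ) : ℂ)) ^ k = (-1) ^ k * jj ^ k := by
      rw [← mul_zpow]
      congr 1
      push_cast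
      ring
    have e2 : (-chi4 (γ 1 1)) ^ k = (-1) ^ k * chi4 (γ 1 1) ^ k := by
      rw [← mul_zpow, neg_one_mul]
    have hsq : ((-1 : ℂ) ^ k) * ((-1 : ℂ) ^ k) = 1 := by
      rw [← mul_zpow, neg_one_mul, neg_neg, one_zpow]
    rw [e1, e2]
    linear_combination (chi4 (γ 1 1) ^ k * jj ^ k * etaQuotient N r τ) * hsq
  · -- `c = 0`: `γ = ±Tⁿ`
    have hdet := det_entries γ
    rcases SL2Z_d_of_c_eq_zero γ hzero with hd | hd
    · have ha : γ 0 0 = 1 := by rw [hzero, hd] at hdet; linarith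
      have hcoe : ((γ • τ : ℍ) : ℂ) = (τ : ℂ) + (γ 0 1 : ℤ) := by
        rw [coe_SL2_smul, ha, hzero, hd]; push_cast; ring
      rw [etaQuotient_of_coe_eq_add_intCast N r h1 hcoe, hzero, hd,
        chi4_of_emod_four_eq_one (by decide)]
      simp
    · have ha : γ 0 0 = -1 := by rw [hzero, hd] at hdet; linarith
      have hcoe : ((γ • τ : ℍ) : ℂ) = (τ : ℂ) + ((-γ 0 1 : ℤ) : ℂ) := by
        rw [coe_SL2_smul, ha, hzero, hd]; push_cast; ring
      rw [etaQuotient_of_coe_eq_add_intCast N r h1 hcoe, hzero, hd,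
        chi4_neg odd_one, chi4_of_emod_four_eq_one (by decide)]
      push_cast
      rw [zero_mul, zero_add, ← mul_zpow, neg_one_mul, neg_neg, one_zpow, one_mul]
  · exact etaQuotient_SL2_smul_of_thetaType N hN r k hc γ (hdvd_of_mem hγ) hpos
      (hodd_of_dvd (hdvd_of_mem hγ)) τ

/-- **Slash form**: `f ∣[k] γ = χ₋₄(d)^k • f` for `γ ∈ Γ₀(N)` (theta type, `4 ∣ N`). [folklore] -/
theorem etaQuotient_slash_of_thetaType (N : ℕ) (hN : 0 < N) (h4 : 4 ∣ N) (r : ℕ → ℤ) (k : ℤ)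
    (hc : ThetaTypeCond N r k) {γ : SL(2, ℤ)} (hγ : γ ∈ Gamma0 N) :
    etaQuotient N r ∣[k] γ = chi4 (γ 1 1) ^ k • etaQuotient N r := by
  funext τ
  rw [SL_slash_apply, ModularGroup.denom_apply, etaQuotient_smul_of_thetaType N hN h4 r k hc hγ,
    Pi.smul_apply, smul_eq_mul, mul_assoc, mul_assoc,
    mul_left_comm (((γ 1 0 : ℂ) * τ + γ 1 1) ^ k), ← zpow_add₀ (SL2_denom_ne_zero γ τ),
    add_neg_cancel, zpow_zero, mul_one]

/-- **Invariance under `Γ₁(N)`**: `f ∣[k] γ = f` for `γ ∈ Γ₁(N)` (theta type, `4 ∣ N`): here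
`d ≡ 1 (mod N)`, so `d ≡ 1 (mod 4)` and `χ₋₄(d) = 1`. [folklore] -/
theorem etaQuotient_slash_of_mem_Gamma1_of_thetaType (N : ℕ) (hN : 0 < N) (h4 : 4 ∣ N)
    (r : ℕ → ℤ) (k : ℤ) (hc : ThetaTypeCond N r k) {γ : SL(2, ℤ)} (hγ : γ ∈ Gamma1 N) :
    etaQuotient N r ∣[k] γ = etaQuotient N r := by
  have hγ' := hγ
  rw [Gamma1_mem] at hγ'
  have h0 : γ ∈ Gamma0 N := by rw [Gamma0_mem]; exact hγ'.2.2
  have hd : γ 1 1 % 4 = 1 := by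
    have h1 : ((γ 1 1 - 1 : ℤ) : ZMod N) = 0 := by push_cast; rw [hγ'.2.1, sub_self]
    have hdvd := (ZMod.intCast_zmod_eq_zero_iff_dvd _ N).mp h1
    have h4' : (4 : ℤ) ∣ γ 1 1 - 1 := (show (4 : ℤ) ∣ (N : ℤ) by exact_mod_cast h4).trans hdvd
    omega
  rw [etaQuotient_slash_of_thetaType N hN h4 r k hc h0, chi4_of_emod_four_eq_one hd, one_zpow,
    one_smul]

/-! ### Size at the cusps -/

/-- **`‖(f ∣[k] γ)(τ)‖² = C · e^{-π·ord·Im τ/(6N)} · Q(τ)`** with `C > 0`, `Q → 1` at `i∞` and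
`ord = cuspOrder24 N r c` (Ligozat), for `f = ∏ η(δτ)^{r_δ}` with `Σ r_δ = 2k` and every
`γ ∈ SL₂(ℤ)` (the computation inside `isZeroAtImInfty_etaQuotient_slash`, recorded as a statement).
[cite: Savitt2025, Rem. 2] -/
theorem exists_norm_sq_etaQuotient_slash (N : ℕ) (hN : 0 < N) (r : ℕ → ℤ) (k : ℤ)
    (hk : ∑ δ ∈ N.divisors, r δ = 2 * k) (γ : SL(2, ℤ)) :
    ∃ (C : ℝ) (Q : ℍ → ℝ), 0 < C ∧ Tendsto Q atImInfty (𝓝 1) ∧ ∀ τ : ℍ,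
      ‖(etaQuotient N r ∣[k] (γ : GL (Fin 2) ℝ)) τ‖ ^ 2 =
        C * Real.exp (-(π / (6 * N)) * (cuspOrder24 N r (γ 1 0) : ℝ) * τ.im) * Q τ := by
  choose C Q hC hQ hnorm using fun δ ↦ exists_norm_eta_natMul_SL2_smul_sq δ γ
  set s : ℝ := ∑ δ ∈ N.divisors, (r δ : ℝ) * (-(π * ((Int.gcd δ (γ 1 0) : ℝ) ^ 2 / δ) / 6)) with hs
  have hsum : s = -(π / (6 * N)) * (cuspOrder24 N r (γ 1 0) : ℝ) := by
    rw [hs, cuspOrder24, Int.cast_sum, Finset.mul_sum]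
    refine Finset.sum_congr rfl fun δ hδ ↦ ?_
    have hδ0 : (δ : ℝ) ≠ 0 := by exact_mod_cast (Nat.pos_of_mem_divisors hδ).ne'
    have hNδ : ((N / δ : ℕ) : ℝ) = (N : ℝ) / δ := by
      rw [Nat.cast_div (Nat.dvd_of_mem_divisors hδ) hδ0]
    rw [Int.cast_mul, Int.cast_mul, Int.cast_pow, Int.cast_natCast, Int.cast_natCast, hNδ]
    have hN0 : (N : ℝ) ≠ 0 := by exact_mod_cast hN.ne'
    field_simp
  refine ⟨∏ δ ∈ N.divisors, C δ ^ (r δ), fun τ ↦ ∏ δ ∈ N.divisors, Q δ τ ^ (r δ),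
    Finset.prod_pos fun δ _ ↦ zpow_pos (hC δ) _, ?_, fun τ ↦ ?_⟩
  · have := tendsto_finsetProd N.divisors
      (fun δ (_ : δ ∈ N.divisors) ↦ ((hQ δ).zpow₀ (m := r δ) (Or.inl one_ne_zero)))
    simpa using this
  have hj := SL2_denom_ne_zero γ τ
  have hjn : ‖(γ 1 0 : ℂ) * τ + γ 1 1‖ ≠ 0 := norm_ne_zero_iff.mpr hj
  rw [← hsum, ← SL_slash, SL_slash_apply (f := etaQuotient N r), ModularGroup.denom_apply,
    etaQuotient_apply, norm_mul, mul_pow, norm_zpow, Complex.norm_prod, ← Finset.prod_pow]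
  have hfac : ∀ δ ∈ N.divisors, ‖η (δ * ((γ • τ : ℍ) : ℂ)) ^ (r δ)‖ ^ 2 =
      ‖(γ 1 0 : ℂ) * τ + γ 1 1‖ ^ (r δ) * ((C δ * Real.exp (-(π * ((Int.gcd δ (γ 1 0) : ℝ) ^ 2
        / δ) * τ.im / 6))) ^ (r δ) * Q δ τ ^ (r δ)) := fun δ hδ ↦ by
    rw [norm_zpow, ← zpow_natCast (‖η (δ * ((γ • τ : ℍ) : ℂ))‖ ^ r δ), ← zpow_mul,
      mul_comm (r δ), zpow_mul, zpow_natCast, hnorm δ (Nat.pos_of_mem_divisors hδ) τ, mul_zpow,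
      mul_zpow]
  rw [Finset.prod_congr rfl hfac, Finset.prod_mul_distrib, Finset.prod_mul_distrib,
    real_prod_zpow_eq_zpow_sum hjn, hk]
  have hcancel :
      ‖(γ 1 0 : ℂ) * τ + γ 1 1‖ ^ (2 * k) * (‖(γ 1 0 : ℂ) * τ + γ 1 1‖ ^ (-k)) ^ 2 = 1 := by
    rw [← zpow_natCast (‖(γ 1 0 : ℂ) * τ + γ 1 1‖ ^ (-k)), ← zpow_mul, ← zpow_add₀ hjn,
      show 2 * k + -k * ((2 : ℕ) : ℤ) = 0 by push_cast; ring, zpow_zero]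
  have hexp : ∏ δ ∈ N.divisors, (C δ * Real.exp (-(π * ((Int.gcd δ (γ 1 0) : ℝ) ^ 2 / δ) *
      τ.im / 6))) ^ (r δ) = (∏ δ ∈ N.divisors, C δ ^ (r δ)) * Real.exp (s * τ.im) := by
    simp_rw [mul_zpow, Finset.prod_mul_distrib, real_exp_zpow, ← Real.exp_sum]
    congr 2
    rw [hs, Finset.sum_mul]
    exact Finset.sum_congr rfl fun δ _ ↦ by ring
  rw [hexp]
  linear_combination (∏ δ ∈ N.divisors, C δ ^ r δ) * Real.exp (s * τ.im) *
    (∏ δ ∈ N.divisors, Q δ τ ^ r δ) * hcancel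

/-- **Boundedness at a cusp of non-negative order**: if `cuspOrder24 N r c ≥ 0` then `f ∣[k] γ` is
bounded at `i∞`. [folklore] -/
theorem isBoundedAtImInfty_etaQuotient_slash (N : ℕ) (hN : 0 < N) (r : ℕ → ℤ) (k : ℤ)
    (hk : ∑ δ ∈ N.divisors, r δ = 2 * k) (γ : SL(2, ℤ)) (hord : 0 ≤ cuspOrder24 N r (γ 1 0)) :
    IsBoundedAtImInfty (etaQuotient N r ∣[k] (γ : GL (Fin 2) ℝ)) := by
  obtain ⟨C, Q, hC, hQ, hformula⟩ := exists_norm_sq_etaQuotient_slash N hN r k hk γ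
  -- `‖f|γ‖² ≤ C · 1 · Q → C`, so `‖f|γ‖²` is eventually `≤ 2C`
  have hQev : ∀ᶠ τ in atImInfty, Q τ ≤ 2 := (hQ.eventually (ge_mem_nhds (by norm_num)))
  rw [IsBoundedAtImInfty, BoundedAtFilter, Asymptotics.isBigO_iff]
  refine ⟨Real.sqrt (C * 2), ?_⟩
  filter_upwards [hQev] with τ hQτ
  rw [Pi.one_apply, norm_one, mul_one]
  have hC0 : 0 ≤ C := hC.le
  have hsq : ‖(etaQuotient N r ∣[k] (γ : GL (Fin 2) ℝ)) τ‖ ^ 2 ≤ C * 2 := by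
    rw [hformula τ]
    have hE : Real.exp (-(π / (6 * N)) * (cuspOrder24 N r (γ 1 0) : ℝ) * τ.im) ≤ 1 := by
      rw [Real.exp_le_one_iff]
      have : 0 ≤ π / (6 * N) * (cuspOrder24 N r (γ 1 0) : ℝ) * τ.im := by
        have h1 : (0 : ℝ) ≤ cuspOrder24 N r (γ 1 0) := by exact_mod_cast hord
        have h2 : 0 ≤ τ.im := τ.im_pos.le
        positivity
      linarith
    have hCe : 0 < C * Real.exp (-(π / (6 * N)) * (cuspOrder24 N r (γ 1 0) : ℝ) * τ.im) := by
      positivity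
    have hQ0 : 0 ≤ Q τ := by
      have h := hformula τ
      have : Q τ = ‖(etaQuotient N r ∣[k] (γ : GL (Fin 2) ℝ)) τ‖ ^ 2 /
          (C * Real.exp (-(π / (6 * N)) * (cuspOrder24 N r (γ 1 0) : ℝ) * τ.im)) := by
        rw [h]
        field_simp
      rw [this]
      positivity
    calc C * Real.exp (-(π / (6 * N)) * (cuspOrder24 N r (γ 1 0) : ℝ) * τ.im) * Q τ
        ≤ C * 1 * 2 := by gcongr
      _ = C * 2 := by ring
  calc ‖(etaQuotient N r ∣[k] (γ : GL (Fin 2) ℝ)) τ‖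
      = Real.sqrt (‖(etaQuotient N r ∣[k] (γ : GL (Fin 2) ℝ)) τ‖ ^ 2) :=
        (Real.sqrt_sq (norm_nonneg _)).symm
    _ ≤ Real.sqrt (C * 2) := Real.sqrt_le_sqrt hsq

/-- **Non-vanishing at a cusp of order `0`**: if `cuspOrder24 N r c = 0` then
`‖(f ∣[k] γ)(τ)‖ → √C > 0` as `Im τ → ∞`. [folklore] -/
theorem tendsto_norm_etaQuotient_slash_of_cuspOrder24_eq_zero (N : ℕ) (hN : 0 < N) (r : ℕ → ℤ)
    (k : ℤ) (hk : ∑ δ ∈ N.divisors, r δ = 2 * k) (γ : SL(2, ℤ))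
    (hord : cuspOrder24 N r (γ 1 0) = 0) :
    ∃ C : ℝ, 0 < C ∧
      Tendsto (fun τ : ℍ ↦ ‖(etaQuotient N r ∣[k] (γ : GL (Fin 2) ℝ)) τ‖) atImInfty (𝓝 C) := by
  obtain ⟨C, Q, hC, hQ, hformula⟩ := exists_norm_sq_etaQuotient_slash N hN r k hk γ
  refine ⟨Real.sqrt C, Real.sqrt_pos.mpr hC, ?_⟩
  have hlim : Tendsto (fun τ : ℍ ↦ ‖(etaQuotient N r ∣[k] (γ : GL (Fin 2) ℝ)) τ‖ ^ 2) atImInfty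
      (𝓝 C) := by
    simp_rw [hformula, hord, Int.cast_zero, mul_zero, zero_mul, Real.exp_zero, mul_one]
    simpa using hQ.const_mul C
  have := hlim.sqrt
  exact this.congr fun τ ↦ by rw [Real.sqrt_sq (norm_nonneg _)]

/-- At a cusp of order `0`, `‖(f ∣[k] γ)(τ)‖` is eventually bounded below by a positive constant.
[folklore] -/
theorem eventually_le_norm_etaQuotient_slash (N : ℕ) (hN : 0 < N) (r : ℕ → ℤ) (k : ℤ)
    (hk : ∑ δ ∈ N.divisors, r δ = 2 * k) (γ : SL(2, ℤ)) (hord : cuspOrder24 N r (γ 1 0) = 0) :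
    ∃ C : ℝ, 0 < C ∧ ∀ᶠ τ in atImInfty, C ≤ ‖(etaQuotient N r ∣[k] (γ : GL (Fin 2) ℝ)) τ‖ := by
  obtain ⟨C, hC, hlim⟩ := tendsto_norm_etaQuotient_slash_of_cuspOrder24_eq_zero N hN r k hk γ hord
  exact ⟨C / 2, by positivity, hlim.eventually (le_mem_nhds (by linarith))⟩

/-! ### The modular form attached to a theta-type exponent vector -/

/-- The order quantity `cuspOrder24 N r c` only depends on `gcd(N, c)` (tree lemma, restated with
the divisor membership needed below). [folklore] -/
theorem cuspOrder24_nonneg_of_forall_divisors (N : ℕ) (hN : N ≠ 0) (r : ℕ → ℤ)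
    (hord : ∀ t ∈ N.divisors, 0 ≤ cuspOrder24 N r t) (c : ℤ) : 0 ≤ cuspOrder24 N r c := by
  rw [cuspOrder24_eq_gcd]
  exact hord _ (Nat.mem_divisors.mpr ⟨Nat.gcd_dvd_left _ _, hN⟩)

/-- **The modular form `∏ η(δτ)^{r_δ} ∈ M_k(Γ₁(N))`** attached to a theta-type exponent vector with
non-negative orders at all cusps (`4 ∣ N`): invariance by
`etaQuotient_slash_of_mem_Gamma1_of_thetaType`, holomorphy by `mdifferentiable_etaQuotient`,
boundedness at every cusp by `isBoundedAtImInfty_etaQuotient_slash`. [folklore] -/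
def etaQuotientFormOfThetaType (N : ℕ) [NeZero N] (h4 : 4 ∣ N) (r : ℕ → ℤ) (k : ℤ)
    (hc : ThetaTypeCond N r k) (hord : ∀ t ∈ N.divisors, 0 ≤ cuspOrder24 N r t) :
    ModularForm (Gamma1 N) k where
  toFun := etaQuotient N r
  slash_action_eq' A hA := by
    obtain ⟨γ, hγ, rfl⟩ := hA
    exact etaQuotient_slash_of_mem_Gamma1_of_thetaType N (NeZero.pos N) h4 r k hc hγ
  holo' := mdifferentiable_etaQuotient N r
  bdd_at_cusps' hcusp := by
    rw [Subgroup.IsArithmetic.isCusp_iff_isCusp_SL2Z] at hcusp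
    rw [OnePoint.isBoundedAt_iff_forall_SL2Z hcusp]
    intro γ _
    exact isBoundedAtImInfty_etaQuotient_slash N (NeZero.pos N) r k hc.sum_eq γ
      (cuspOrder24_nonneg_of_forall_divisors N (NeZero.ne N) r hord _)

/-- The underlying function. [folklore] -/
@[simp]
theorem coe_etaQuotientFormOfThetaType (N : ℕ) [NeZero N] (h4 : 4 ∣ N) (r : ℕ → ℤ) (k : ℤ)
    (hc : ThetaTypeCond N r k) (hord : ∀ t ∈ N.divisors, 0 ≤ cuspOrder24 N r t) :
    (etaQuotientFormOfThetaType N h4 r k hc hord : ℍ → ℂ) = etaQuotient N r := rfl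

/-! ### Changing the level -/

/-- `Γ₁(N) ≤ Γ₁(M)` for `M ∣ N`. [folklore] -/
theorem Gamma1_le_Gamma1_of_dvd {M N : ℕ} (h : M ∣ N) : Gamma1 N ≤ Gamma1 M := by
  intro γ hγ
  rw [Gamma1_mem] at hγ ⊢
  obtain ⟨h00, h11, h10⟩ := hγ
  refine ⟨?_, ?_, ?_⟩
  · have := congrArg (ZMod.castHom h (ZMod M)) h00
    rwa [map_intCast, map_one] at this
  · have := congrArg (ZMod.castHom h (ZMod M)) h11
    rwa [map_intCast, map_one] at this
  · have := congrArg (ZMod.castHom h (ZMod M)) h10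
    rwa [map_intCast, map_zero] at this

/-- A modular form for `Γ' ≤ SL₂(ℤ)` viewed as a modular form for a subgroup `Γ ≤ Γ'` (cf.
`ofLevelOne`). [folklore] -/
def ofLevelLe {Γ Γ' : Subgroup SL(2, ℤ)} (h : Γ ≤ Γ') {k : ℤ} (f : ModularForm Γ' k) :
    ModularForm Γ k where
  toFun := f
  slash_action_eq' A hA := by
    obtain ⟨γ, hγ, rfl⟩ := hA
    exact f.slash_action_eq' _ ⟨γ, h hγ, rfl⟩
  holo' := f.holo'
  bdd_at_cusps' hc := f.bdd_at_cusps' (hc.mono fun A hA ↦ by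
    obtain ⟨γ, hγ, rfl⟩ := hA
    exact ⟨γ, h hγ, rfl⟩)

/-- `ofLevelLe` does not change the underlying function. [folklore] -/
@[simp]
theorem coe_ofLevelLe {Γ Γ' : Subgroup SL(2, ℤ)} (h : Γ ≤ Γ') {k : ℤ} (f : ModularForm Γ' k) :
    (ofLevelLe h f : ℍ → ℂ) = f := rfl

/-! ### The two weight-one `η`-quotients of level `8` -/

/-- Exponents of `η(2τ)¹⁰ η(τ)⁻⁴ η(4τ)⁻⁴` (`= θ(τ)²`, Köhler 2011, §1.2; not used). [folklore] -/
def thetaSqExp : ℕ → ℤ :=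
  fun δ ↦ if δ = 1 then -4 else if δ = 2 then 10 else if δ = 4 then -4 else 0

/-- Exponents of `η(4τ)¹⁰ η(2τ)⁻⁴ η(8τ)⁻⁴` (`= θ(2τ)²`; not used). [folklore] -/
def thetaSqTwoExp : ℕ → ℤ :=
  fun δ ↦ if δ = 2 then -4 else if δ = 4 then 10 else if δ = 8 then -4 else 0

/-- `η(2τ)¹⁰ η(τ)⁻⁴ η(4τ)⁻⁴` is of theta type in weight `1` at level `8`. [folklore] -/
theorem thetaTypeCond_thetaSqExp : ThetaTypeCond 8 thetaSqExp 1 where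
  sum_eq := by decide
  sum_mul_eq := by decide
  sum_div_eq := by decide
  even := by decide

/-- `η(4τ)¹⁰ η(2τ)⁻⁴ η(8τ)⁻⁴` is of theta type in weight `1` at level `8`. [folklore] -/
theorem thetaTypeCond_thetaSqTwoExp : ThetaTypeCond 8 thetaSqTwoExp 1 where
  sum_eq := by decide
  sum_mul_eq := by decide
  sum_div_eq := by decide
  even := by decide

/-- Ligozat's orders of `η(2τ)¹⁰ η(τ)⁻⁴ η(4τ)⁻⁴` at the cusps of level `8` are `≥ 0` (they are
`0, 96, 0, 0` at `gcd(c, 8) = 1, 2, 4, 8`). [folklore] -/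
theorem cuspOrder24_thetaSqExp_nonneg : ∀ t ∈ Nat.divisors 8, 0 ≤ cuspOrder24 8 thetaSqExp t := by
  decide

/-- Ligozat's orders of `η(4τ)¹⁰ η(2τ)⁻⁴ η(8τ)⁻⁴` at the cusps of level `8` are `≥ 0` (they are
`0, 0, 192, 0` at `gcd(c, 8) = 1, 2, 4, 8`). [folklore] -/
theorem cuspOrder24_thetaSqTwoExp_nonneg :
    ∀ t ∈ Nat.divisors 8, 0 ≤ cuspOrder24 8 thetaSqTwoExp t := by
  decide

/-- **No common zero at the cusps**: for every `c`, one of the two orders vanishes. [folklore] -/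
theorem cuspOrder24_thetaSq_eq_zero_or (c : ℤ) :
    cuspOrder24 8 thetaSqExp c = 0 ∨ cuspOrder24 8 thetaSqTwoExp c = 0 := by
  have key : ∀ t ∈ Nat.divisors 8,
      cuspOrder24 8 thetaSqExp t = 0 ∨ cuspOrder24 8 thetaSqTwoExp t = 0 := by decide
  rw [cuspOrder24_eq_gcd 8 thetaSqExp, cuspOrder24_eq_gcd 8 thetaSqTwoExp]
  exact key _ (Nat.mem_divisors.mpr ⟨Nat.gcd_dvd_left _ _, by norm_num⟩)

/-- **`η(2τ)¹⁰ η(τ)⁻⁴ η(4τ)⁻⁴ ∈ M₁(Γ₁(8))`.** [folklore] -/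
def thetaSqForm8 : ModularForm (Gamma1 8) 1 :=
  etaQuotientFormOfThetaType 8 ⟨2, rfl⟩ thetaSqExp 1 thetaTypeCond_thetaSqExp
    cuspOrder24_thetaSqExp_nonneg

/-- **`η(4τ)¹⁰ η(2τ)⁻⁴ η(8τ)⁻⁴ ∈ M₁(Γ₁(8))`.** [folklore] -/
def thetaSqTwoForm8 : ModularForm (Gamma1 8) 1 :=
  etaQuotientFormOfThetaType 8 ⟨2, rfl⟩ thetaSqTwoExp 1 thetaTypeCond_thetaSqTwoExp
    cuspOrder24_thetaSqTwoExp_nonneg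

/-- The first weight-one `η`-quotient as a form on `Γ₁(N)`, `8 ∣ N`. [folklore] -/
def thetaSqForm (N : ℕ) (h : 8 ∣ N) : ModularForm (Gamma1 N) 1 :=
  ofLevelLe (Gamma1_le_Gamma1_of_dvd h) thetaSqForm8

/-- The second weight-one `η`-quotient as a form on `Γ₁(N)`, `8 ∣ N`. [folklore] -/
def thetaSqTwoForm (N : ℕ) (h : 8 ∣ N) : ModularForm (Gamma1 N) 1 :=
  ofLevelLe (Gamma1_le_Gamma1_of_dvd h) thetaSqTwoForm8

/-- Underlying function of `thetaSqForm`. [folklore] -/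
@[simp]
theorem coe_thetaSqForm (N : ℕ) (h : 8 ∣ N) :
    (thetaSqForm N h : ℍ → ℂ) = etaQuotient 8 thetaSqExp := rfl

/-- Underlying function of `thetaSqTwoForm`. [folklore] -/
@[simp]
theorem coe_thetaSqTwoForm (N : ℕ) (h : 8 ∣ N) :
    (thetaSqTwoForm N h : ℍ → ℂ) = etaQuotient 8 thetaSqTwoExp := rfl

/-- The two forms do not vanish on `ℍ`. [folklore] -/
theorem thetaSqForm_ne_zero (N : ℕ) (h : 8 ∣ N) (τ : ℍ) :
    thetaSqForm N h τ ≠ 0 ∧ thetaSqTwoForm N h τ ≠ 0 :=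
  ⟨etaQuotient_ne_zero 8 _ τ, etaQuotient_ne_zero 8 _ τ⟩

/-- **Transformation under `Γ₀(N)`** (`8 ∣ N`): `g ∣[1] γ = χ₋₄(d) • g` for both forms `g`.
[folklore] -/
theorem thetaSqForm_slash_of_mem_Gamma0 {N : ℕ} (h : 8 ∣ N) {γ : SL(2, ℤ)} (hγ : γ ∈ Gamma0 N) :
    (thetaSqForm N h : ℍ → ℂ) ∣[(1 : ℤ)] γ = chi4 (γ 1 1) • (thetaSqForm N h : ℍ → ℂ) ∧
      (thetaSqTwoForm N h : ℍ → ℂ) ∣[(1 : ℤ)] γ = chi4 (γ 1 1) • (thetaSqTwoForm N h : ℍ → ℂ) := by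
  have h0 : γ ∈ Gamma0 8 := gamma0_le_gamma0_of_dvd h hγ
  have h1 := etaQuotient_slash_of_thetaType 8 (by norm_num) ⟨2, rfl⟩ thetaSqExp 1
    thetaTypeCond_thetaSqExp h0
  have h2 := etaQuotient_slash_of_thetaType 8 (by norm_num) ⟨2, rfl⟩ thetaSqTwoExp 1
    thetaTypeCond_thetaSqTwoExp h0
  rw [zpow_one] at h1 h2
  exact ⟨h1, h2⟩

/-- **At every cusp one of the two forms is bounded away from `0`**: for every `γ ∈ SL₂(ℤ)` there
is `C > 0` with `C ≤ ‖(g ∣[1] γ)(τ)‖` for all `τ` near `i∞`, for `g` one of `thetaSqForm`,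
`thetaSqTwoForm` — the two forms have no common zero on `ℍ ∪ {cusps}`. [folklore] -/
theorem exists_eventually_le_norm_thetaSqForm_slash (N : ℕ) (h : 8 ∣ N) (γ : SL(2, ℤ)) :
    ∃ C : ℝ, 0 < C ∧
      ((∀ᶠ τ in atImInfty, C ≤ ‖((thetaSqForm N h : ℍ → ℂ) ∣[(1 : ℤ)] (γ : GL (Fin 2) ℝ)) τ‖) ∨
        ∀ᶠ τ in atImInfty,
          C ≤ ‖((thetaSqTwoForm N h : ℍ → ℂ) ∣[(1 : ℤ)] (γ : GL (Fin 2) ℝ)) τ‖) := by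
  rcases cuspOrder24_thetaSq_eq_zero_or (γ 1 0) with h1 | h2
  · obtain ⟨C, hC, hev⟩ := eventually_le_norm_etaQuotient_slash 8 (by norm_num) thetaSqExp 1
      thetaTypeCond_thetaSqExp.sum_eq γ h1
    exact ⟨C, hC, Or.inl hev⟩
  · obtain ⟨C, hC, hev⟩ := eventually_le_norm_etaQuotient_slash 8 (by norm_num) thetaSqTwoExp 1
      thetaTypeCond_thetaSqTwoExp.sum_eq γ h2
    exact ⟨C, hC, Or.inr hev⟩

end Literature.NumberTheory.EllipticCurves.ModularForms
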